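import Literature.NumberTheory.EllipticCurves.EisensteinKroneckerNumbers
import HarnessLib

/-!
# Lattice sums over a superlattice, coset by coset; the distribution relation of the two-index
# Eisenstein–Kronecker numbers (de Shalit II.3.1 (6), II.3.4 (11))

Topic `Literature/NumberTheory/EllipticCurves` (complex-lattice cluster); theorems only, deliberate
dot-notation extensions of Mathlib's `PeriodPair`, continuing `EisensteinKroneckerNumbers.lean`
(`PeriodPair.eisensteinKronecker L j k z = (k−1)!·A(L)^{−j}·Σ_{ω∈Λ}(z̄+ω̄)^j(z+ω)^{−k}`, the absolutely
convergent range `k ≥ j + 3` of II.3.1 (6)) and `EisensteinNumbersDistribution.lean` (II.3.4 (11) for the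
holomorphic `E_k`, by differentiation).

For ABSOLUTELY convergent lattice sums the distribution relation is a REARRANGEMENT: with `S ∋ 0` a
system of representatives of `Λ'/Λ`, the map `(c, l) ↦ c + l` is a bijection `S × Λ → Λ'`. We prove

* `PeriodPair.tsum_lattice_eq_sum_tsum_of_reps` — for a summable `f : Λ' → E`,
  `Σ_{l' ∈ Λ'} f(l') = Σ_{c ∈ S} Σ_{l ∈ Λ} f(c + l)`;
* ★ `PeriodPair.sum_eisensteinKronecker_add_eq` — for `k ≥ j + 3` and every `z`,
  **`Σ_{c ∈ S} E_{−j,k}(z + c, Λ) = N^{−j}·E_{−j,k}(z, Λ')`** (`N = #S`; the factor `N^{−j}` is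
  `(A(Λ')/A(Λ))^{−j}`, `A(Λ')⁻¹ = N·A(Λ)⁻¹` — de Shalit's `N𝔪^{−j}` normalisations in II.3.5 (13));
  at `j = 0` this re-proves II.3.4 (11) for `E_k`, `k ≥ 3`, by rearrangement (and at every `z`, the
  lattice points included, where both sides take the same junk-free values of the `l ≠ −z` sums).

References: E. de Shalit (1987), II.3.1 (6), II.3.4 (11), II.3.5 (13) [deShalit1987].

Mathlib / tree search: Mathlib `Equiv.ofBijective`, `Equiv.tsum_eq`, `Summable.tsum_prod`, `tsum_fintype`,
`Finset.sum_coe_sort`; tree `areaInv_eq_of_reps`, `hasSum_eisensteinKronecker`, `mem_of_mem_reps`,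
`le_of_reps`, `reps_unique` (`WeierstrassTransformationFive`).
-/

noncomputable section

open Complex
open scoped ComplexConjugate Nat

namespace PeriodPair

variable {L L' : PeriodPair} {S : Finset ℂ}

section Reps

variable (hS : ∀ x, x ∈ L'.lattice ↔ ∃ c ∈ S, x - c ∈ L.lattice) (hS0 : (0 : ℂ) ∈ S)
  (hSd : ∀ c ∈ S, ∀ c' ∈ S, c - c' ∈ L.lattice → c = c')
include hS hS0 hSd

/-- **`(c, l) ↦ c + l` is a bijection `S × Λ ≃ Λ'`** for a system of representatives `S` of `Λ'/Λ`.
[cite: deShalit1987, II.3.4 (11)] -/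
theorem bijective_repAdd :
    Function.Bijective (fun p : S × L.lattice ↦
      (⟨(p.1 : ℂ) + p.2, add_mem (mem_of_mem_reps hS p.1.2) (le_of_reps hS hS0 p.2.2)⟩ : L'.lattice)) := by
  constructor
  · rintro ⟨⟨c, hc⟩, ⟨l, hl⟩⟩ ⟨⟨c', hc'⟩, ⟨l', hl'⟩⟩ h
    simp only [Subtype.mk.injEq] at h
    have hcc : c = c' := by
      refine hSd c hc c' hc' ?_
      have : c - c' = l' - l := by linear_combination h
      rw [this]; exact sub_mem hl' hl
    subst hcc
    have hll : l = l' := by linear_combination h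
    subst hll
    rfl
  · rintro ⟨x, hx⟩
    obtain ⟨c, hc, hxc⟩ := (hS x).mp hx
    exact ⟨⟨⟨c, hc⟩, ⟨x - c, hxc⟩⟩, by simp⟩

/-- **A summable lattice sum over `Λ'` splits coset by coset**: `Σ_{l' ∈ Λ'} f(l') = Σ_{c ∈ S} Σ_{l ∈ Λ}
f(c + l)`. [cite: deShalit1987, II.3.4 (11)] -/
theorem tsum_lattice_eq_sum_tsum_of_reps {E : Type*} [NormedAddCommGroup E] [NormedSpace ℝ E]
    [CompleteSpace E] {f : ℂ → E} (hf : Summable fun l' : L'.lattice ↦ f l') :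
    ∑' l' : L'.lattice, f l' = ∑ c ∈ S, ∑' l : L.lattice, f (c + l) := by
  let g : S × L.lattice → L'.lattice := fun p ↦
    ⟨(p.1 : ℂ) + p.2, add_mem (mem_of_mem_reps hS p.1.2) (le_of_reps hS hS0 p.2.2)⟩
  have hg : Function.Bijective g := bijective_repAdd hS hS0 hSd
  have h1 : ∑' p : S × L.lattice, f (g p) = ∑' l' : L'.lattice, f l' :=
    (Equiv.ofBijective g hg).tsum_eq (fun l' : L'.lattice ↦ f l')
  have hf' : Summable fun p : S × L.lattice ↦ f (g p) :=
    ((Equiv.ofBijective g hg).summable_iff (f := fun l' : L'.lattice ↦ f (l' : ℂ))).mpr hf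
  rw [← h1, hf'.tsum_prod, tsum_fintype]
  exact Finset.sum_coe_sort S (fun c ↦ ∑' l : L.lattice, f (c + l))

/-- ★ **The distribution relation of the two-index Eisenstein–Kronecker numbers** (absolutely convergent
range `k ≥ j + 3`, every `z`): `Σ_{c ∈ S} E_{−j,k}(z + c, Λ) = N^{−j}·E_{−j,k}(z, Λ')`, `N = #S` — a
rearrangement of (6) over the cosets of `Λ` in `Λ'`, with `A(Λ')⁻¹ = N·A(Λ)⁻¹`. At `j = 0` this is
II.3.4 (11) for `E_k`, `k ≥ 3`. [cite: deShalit1987, II.3.1 (6), II.3.4 (11)] -/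
theorem sum_eisensteinKronecker_add_eq {j k : ℕ} (hk : j + 3 ≤ k) (z : ℂ) :
    ∑ c ∈ S, L.eisensteinKronecker j k (z + c) =
      ((S.card : ℂ) ^ j)⁻¹ * L'.eisensteinKronecker j k z := by
  -- summability of the general term of (6) over `Λ'`
  have hsum : Summable fun l' : L'.lattice ↦ conj (z + l') ^ j * ((z + l') ^ k)⁻¹ := by
    refine .of_norm_bounded (ZLattice.summable_norm_sub_zpow L'.lattice ((j : ℤ) - k)
      (by rw [finrank_lattice]; push_cast; omega) (-z)) fun ω ↦ ?_
    rw [sub_neg_eq_add, add_comm]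
    exact norm_conj_pow_mul_inv_pow_le j k _
  have hsplit := tsum_lattice_eq_sum_tsum_of_reps hS hS0 hSd
    (f := fun w : ℂ ↦ conj (z + w) ^ j * ((z + w) ^ k)⁻¹) hsum
  -- the card of `S` is positive, so the power of `N` is invertible
  have hN : ((S.card : ℂ) ^ j) ≠ 0 := pow_ne_zero _ (Nat.cast_ne_zero.mpr (Finset.card_pos.mpr ⟨0, hS0⟩).ne')
  rw [eisensteinKronecker_def, areaInv_eq_of_reps hS hS0 hSd, hsplit, mul_pow, Finset.mul_sum,
    Finset.mul_sum]
  refine Finset.sum_congr rfl fun c _ ↦ ?_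
  rw [eisensteinKronecker_def]
  have : ∀ l : L.lattice, conj (z + (c + (l : ℂ))) ^ j * ((z + (c + (l : ℂ))) ^ k)⁻¹ =
      conj (z + c + (l : ℂ)) ^ j * ((z + c + (l : ℂ)) ^ k)⁻¹ := fun l ↦ by rw [add_assoc]
  simp_rw [this]
  field_simp

/-- The case `j = 0`, `k ≥ 3`: II.3.4 (11) for `E_k` at EVERY `z` by rearrangement,
`Σ_{c ∈ S} E_k(z + c, Λ) = E_k(z, Λ')`. [cite: deShalit1987, II.3.4 (11)] -/
theorem sum_eisensteinE_add_eq_of_three_le {k : ℕ} (hk : 3 ≤ k) (z : ℂ) :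
    ∑ c ∈ S, L.eisensteinE k (z + c) = L'.eisensteinE k z := by
  have h := sum_eisensteinKronecker_add_eq hS hS0 hSd (j := 0) (k := k) (by omega) z
  simp only [pow_zero, inv_one, one_mul] at h
  simpa only [eisensteinKronecker_zero_left _ hk] using h

end Reps

/-! ### Summability of the weight-`k` sums, `k ≥ 3` -/

/-- **II.3.1 (6) at `j = 0` as a `HasSum` statement**: for `k ≥ 3`,
`Σ_{ω ∈ Λ}(k−1)!·(z + ω)^{−k}` converges absolutely to `E_k(z, L)`. [cite: deShalit1987, II.3.1 (6)] -/
theorem hasSum_eisensteinE (L : PeriodPair) {k : ℕ} (hk : 3 ≤ k) (z : ℂ) :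
    HasSum (fun ω : L.lattice ↦ ((k - 1)! : ℂ) * ((z + ω) ^ k)⁻¹) (L.eisensteinE k z) := by
  have h := L.hasSum_eisensteinKronecker (j := 0) (k := k) (by omega) z
  rw [eisensteinKronecker_zero_left _ hk] at h
  simpa only [pow_zero, mul_one, one_mul] using h

/-- For `k ≥ 3` the family `(z + ω)^{−k}`, `ω ∈ Λ`, is summable. [cite: deShalit1987, II.3.1 (6)] -/
theorem summable_inv_pow_add_coe (L : PeriodPair) {k : ℕ} (hk : 3 ≤ k) (z : ℂ) :
    Summable fun ω : L.lattice ↦ ((z + ω) ^ k)⁻¹ := by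
  have h := (L.hasSum_eisensteinE hk z).summable.mul_left (((k - 1)! : ℂ)⁻¹)
  refine h.congr fun ω ↦ ?_
  rw [← mul_assoc, inv_mul_cancel₀ (Nat.cast_ne_zero.mpr (Nat.factorial_ne_zero _)), one_mul]

end PeriodPair


end
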